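import Summits.BirchSwinnertonDyer.Rank1Residual.X2.NonPrimitiveSelmerDual
import Literature.NumberTheory.EllipticCurves.IwasawaSelmerDualUniquenessProofs
import Literature.NumberTheory.EllipticCurves.Greenberg1999.NoProperFiniteIndexSubmodule
import HarnessLib

/-!
# No non-zero finite `Λ`-submodule in the NON-PRIMITIVE dual `X^{Σ₀} = Sel^{Σ₀}_E(K_∞)_p^` — from
# the primitive dual and the `p`-divisibility of `Sel^{Σ₀}/Sel` (cell `b2b-bsdres`, team n1011, seat
# p12 (gen 6); row T-A240-K, FILE K3; supplies the `hnf` binders of gen-5 FILE 5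
# `…nonPrimitive_lambdaInvariant_eq_of_torsionIso` on both sides of a congruence)

HONEST FRAMING (cell `b2b-bsdres`, run/shared/lean/b2b/bsd-rank1-residual/, verbatim in every
file): the goal of the cell is to DELETE the COMBINATION-SHAPED residual classes of the
Birch–Swinnerton-Dyer formula for ALL analytic-rank `≤ 1` elliptic curves over `ℚ` — "full BSD
formula for every rank `≤ 1` curve in class `C`" assembled STRICTLY from published theorems — so
that the rank-`≤ 1` remainder becomes exactly the CONSTRUCTION-SHAPED classes, which are TYPED
(missing-input `Prop`s), NOT attempted. This is not "finishing BSD". Team n1011: research routes on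
CONSTRUCTION-SHAPED classes; prove what is provable now; no claim beyond stated classes; census
output = EVIDENCE, never a Literature fact; RESIDUAL-MAP marks UNCHANGED; nothing is booked by this
file. THEOREMS ONLY: no definition, no named fact. X2's `NonPrimitiveSelmerDual`, the tree's
`SelmerDualData.toDual_smul` and A234 are consumed BY NAME.

## What and why

On a defect-2 congruence link, gen-5 FILE 5 transfers `λ(X^{Σ₀}_1) = λ(X^{Σ₀}_2)` GIVEN that both
non-primitive duals have no non-zero finite `Λ`-submodule (explicit binders `hnf₁`, `hnf₂`). Print
gives this from Greenberg 1999 Prop. 4.14 on the PRIMITIVE dual (tree record A234) and GV Cor. (2.3):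
`S^{Σ₀}/S ≅ ∏_{ℓ∈Σ₀} 𝓗_ℓ(ℚ_∞)`, "`𝓗_ℓ(ℚ_∞)` is a divisible group for each `l`" (p. 17) — the dual
of `0 → S → S^{Σ₀} → S^{Σ₀}/S → 0` reads `0 → (S^{Σ₀}/S)^ → X^{Σ₀} → X → 0` with a `ℤ_p`-torsion-free
kernel, so a finite `Λ`-submodule of `X^{Σ₀}` injects into one of `X`. THIS FILE is that step, in the
tree's Pontryagin-dual currency (`SelmerDualData` / `NonPrimitiveDualData`), for ANY number field
`K`, any `ℤ_p`-extension with a topological generator `γ`, any `E/K`, any `Σ₀`: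

* §1 `NonPrimitiveDualData.toDual_smul` — the `Λ`-action of ANY non-primitive dual datum is forced
  (port of `SelmerDualData.toDual_smul` to `Sel^{Σ₀}`; X2's `isLocNil_conjNonPrimitive_sub_one`);
* §2 `smulFun_comp_inclusion` — the canonical action is natural along `Sel ↪ Sel^{Σ₀}`;
* §3 `exists_restrictDual (hγ) (D) (DS)` — the dual `DS.X →ₗ[Λ] D.X` of the inclusion exists, `Λ`-LINEAR
  (existence statement; no definition introduced);
* §4 **`nonPrimitive_noFiniteSubmodule_of_quotient_divisible (hγ) (D) (DS) (hdiv) (hnf) :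
  ∀ N : Submodule Λ DS.X, Finite N → N = ⊥`** — `hdiv : Sel^{Σ₀}/Sel` is `p`-divisible (GV Cor. (2.3)
  + p. 17, in classical currency: `∀ s ∈ Sel^{Σ₀}, ∃ t ∈ Sel^{Σ₀}, p t − s ∈ Sel`), `hnf` on `X`;
* §5 over `ℚ`: `nonPrimitive_noFiniteSubmodule_of_prop414 (h414) (htors) (hκ) (hγ) (D) (hD) (DS) (hdiv)`
  — with A234 (`h414`, `p ∤ #E(ℚ)_tors`, `Sel` cotorsion) supplying `hnf` on `X`.

The binder `hdiv` is the classical-currency form of conclusion 5 of n1011-lit's T-GV23L record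
`GreenbergVatsal2000.datumSelmer_nonPrimitive_invariants` (filing); it is transported from the datum
groups `S_A ⊆ S^{Σ₀}_A` by p06's T-A240-PORT (K1/K2) and discharged in FILE K4. NOT here: the
divisibility itself, GV (7), anything about `μ`.

References: [GreenbergVatsal2000] §2 Cor. (2.3), Prop. (2.5), Lemma (2.6) (arXiv:math/9906215 pp. 20–23),
p. 17; [GreenbergLNM1716] §1 (after Conj. 1.3) (the forced `Λ`-action), Prop. 4.14; Washington GTM 83
§13.2 (Pontryagin duality bookkeeping).
-/

set_option autoImplicit false

noncomputable section

open scoped Classical NumberField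

open NumberField IsDedekindDomain Field WeierstrassCurve
  Literature.NumberTheory.EllipticCurves
  Literature.NumberTheory.EllipticCurves.GreenbergVatsal2000
  Summit.BirchSwinnertonDyer.Rank1Residual.X2.NonPrimitiveSelmerDual

universe u

namespace Summit.BirchSwinnertonDyer.Rank1Residual.Additive

/-! ## §1. The `Λ`-action of ANY non-primitive dual datum is forced -/

section Forced

variable {K : Type u} [Field K] [NumberField K] {W : WeierstrassCurve K} {p : ℕ} [Fact p.Prime]
  {κ : ZpExtension K p} {γ : absoluteGaloisGroup K} {S₀ : Set (HeightOneSpectrum (𝓞 K))}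

/-- Induction carrier for `NonPrimitiveDualData.toDual_smul` (port of
`SelmerDualData.toDual_smul_apply_of_pow_apply_eq_zero` to `Sel^{Σ₀}`): on classes killed by
`ψ^N`, `ψ = conj_γ − 1`, the action of any non-primitive dual datum read through `toDual` is the
canonical finite sum `IsLocNil.smulFun`. [cite: GreenbergLNM1716, §1 (after Conj. 1.3)] -/
theorem NonPrimitiveDualData.toDual_smul_apply_of_pow_apply_eq_zero (hγ : κ.IsTopGenerator γ)
    (DS : NonPrimitiveDualData W κ γ S₀) (N : ℕ) :
    ∀ (s : nonPrimitiveSelmerInfty W κ S₀), ((conjNonPrimitive W κ S₀ γ - 1) ^ N) s = 0 →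
      ∀ (f : IwasawaAlgebra p) (x : DS.X),
        DS.toDual (f • x) s =
          (isLocNil_conjNonPrimitive_sub_one W κ S₀ hγ).smulFun f (DS.toDual x) s := by
  set h := isLocNil_conjNonPrimitive_sub_one W κ S₀ hγ
  set ψ : AddMonoid.End (nonPrimitiveSelmerInfty W κ S₀) := conjNonPrimitive W κ S₀ γ - 1 with hψ
  induction N with
  | zero =>
    intro s hs f x
    rw [pow_zero, AddMonoid.End.one_apply] at hs
    rw [hs, map_zero, map_zero]
  | succ N ih =>
    intro s hs f x
    obtain ⟨k, hk⟩ := h.torsion s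
    have hψs : (ψ ^ N) (ψ s) = 0 := by
      rwa [pow_succ, AddMonoid.End.coe_mul, Function.comp_apply] at hs
    have hψeval : ∀ y : DS.X, DS.toDual y (ψ s) =
        DS.toDual y ⟨W.conjH1 p κ.kerSubgroup γ s, DS.conj_mem s s.2⟩ - DS.toDual y s := fun y ↦ by
      rw [hψ, IwasawaDual.End_sub_apply, AddMonoid.End.one_apply, map_sub]
      rfl
    set g : IwasawaAlgebra p := PowerSeries.mk fun n ↦ PowerSeries.coeff (n + 1) f
    set a : ℤ_[p] := PowerSeries.constantCoeff f
    have hf : f = PowerSeries.X * g + PowerSeries.C a := PowerSeries.eq_X_mul_shift_add_const f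
    have lhs : DS.toDual (f • x) s =
        DS.toDual (g • x) (ψ s) + (PadicInt.toZModPow k a).val • DS.toDual x s := by
      conv_lhs => rw [hf]
      rw [add_smul, mul_smul, map_add, AddMonoidHom.add_apply, DS.toDual_T_smul,
        DS.toDual_C_smul a x s k hk, hψeval]
    have rhs : h.smulFun f (DS.toDual x) s =
        h.smulFun g (DS.toDual x) (ψ s) + (PadicInt.toZModPow k a).val • DS.toDual x s := by
      conv_lhs => rw [hf]
      rw [h.smulFun_add_left, h.smulFun_mul_left, AddMonoidHom.add_apply, h.smulFun_X_apply,
        h.smulFun_C_apply a (DS.toDual x) hk]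
    rw [lhs, rhs, ih (ψ s) hψs g x]

/-- **The `Λ`-action of a `NonPrimitiveDualData` is forced** (`γ` a topological generator): for any
Pontryagin-dual datum `DS` of `Sel^{Σ₀}_E(K_∞)_p` and all `f ∈ Λ`, `x ∈ X^{Σ₀}`:
`toDual (f • x) = f ⋆ toDual x` for the canonical action `IsLocNil.smulFun` attached to
`ψ = conj_γ − 1` (locally nilpotent on the `p`-primary `Sel^{Σ₀}`, X2's
`isLocNil_conjNonPrimitive_sub_one`). Port of `SelmerDualData.toDual_smul`.
[cite: GreenbergLNM1716, §1 (after Conj. 1.3)] -/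
theorem NonPrimitiveDualData.toDual_smul (hγ : κ.IsTopGenerator γ)
    (DS : NonPrimitiveDualData W κ γ S₀) (f : IwasawaAlgebra p) (x : DS.X) :
    DS.toDual (f • x) = (isLocNil_conjNonPrimitive_sub_one W κ S₀ hγ).smulFun f (DS.toDual x) := by
  ext s
  obtain ⟨N, hN⟩ := (isLocNil_conjNonPrimitive_sub_one W κ S₀ hγ).nil s
  exact NonPrimitiveDualData.toDual_smul_apply_of_pow_apply_eq_zero hγ DS N s hN f x

end Forced

/-! ## §2. Naturality of the canonical action along `Sel ↪ Sel^{Σ₀}` -/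

section Naturality

variable {K : Type u} [Field K] [NumberField K] (W : WeierstrassCurve K) {p : ℕ} [Fact p.Prime]
  (κ : ZpExtension K p) (γ : absoluteGaloisGroup K) (S₀ : Set (HeightOneSpectrum (𝓞 K)))

/-- The inclusion `Sel_{p^∞}(E/K_∞) ↪ Sel^{Σ₀}_E(K_∞)_p` intertwines `conj_γ` (both are the same map
on `H¹(K_∞, E[p^∞])`). [folklore] -/
theorem inclusion_conjSelmerInfty (s : W.selmerInfty κ) :
    AddSubgroup.inclusion (selmerInfty_le_nonPrimitiveSelmerInfty W κ S₀) (W.conjSelmerInfty κ γ s) =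
      conjNonPrimitive W κ S₀ γ
        (AddSubgroup.inclusion (selmerInfty_le_nonPrimitiveSelmerInfty W κ S₀) s) :=
  Subtype.ext (by
    simp only [AddSubgroup.coe_inclusion, coe_conjSelmerInfty_apply, coe_conjNonPrimitive_apply])

/-- The inclusion intertwines `ψ = conj_γ − 1`. [folklore] -/
theorem inclusion_conj_sub_one_apply (s : W.selmerInfty κ) :
    AddSubgroup.inclusion (selmerInfty_le_nonPrimitiveSelmerInfty W κ S₀)
        ((W.conjSelmerInfty κ γ - 1) s) =
      (conjNonPrimitive W κ S₀ γ - 1)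
        (AddSubgroup.inclusion (selmerInfty_le_nonPrimitiveSelmerInfty W κ S₀) s) := by
  rw [IwasawaDual.End_sub_apply, IwasawaDual.End_sub_apply, AddMonoid.End.one_apply,
    AddMonoid.End.one_apply, map_sub, inclusion_conjSelmerInfty]

/-- The same for the powers of `ψ`. [folklore] -/
theorem inclusion_conj_sub_one_pow_apply (i : ℕ) (s : W.selmerInfty κ) :
    AddSubgroup.inclusion (selmerInfty_le_nonPrimitiveSelmerInfty W κ S₀)
        (((W.conjSelmerInfty κ γ - 1) ^ i) s) =
      ((conjNonPrimitive W κ S₀ γ - 1) ^ i)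
        (AddSubgroup.inclusion (selmerInfty_le_nonPrimitiveSelmerInfty W κ S₀) s) := by
  induction i generalizing s with
  | zero => rw [pow_zero, pow_zero, AddMonoid.End.one_apply, AddMonoid.End.one_apply]
  | succ i ih =>
    rw [pow_succ, pow_succ, AddMonoid.End.coe_mul, AddMonoid.End.coe_mul, Function.comp_apply,
      Function.comp_apply, ih, inclusion_conj_sub_one_apply]

/-- **Naturality of the canonical `Λ`-action along `Sel ↪ Sel^{Σ₀}`**: restricting a character of
`Sel^{Σ₀}` to `Sel` commutes with `f ⋆ ·` (`γ` a topological generator on the `Sel^{Σ₀}` side; the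
`Sel` side uses the any-`γ` structure `isLocNil_conjSelmerInfty_sub_one'`). [folklore] -/
theorem smulFun_comp_inclusion (hγ : κ.IsTopGenerator γ) (f : IwasawaAlgebra p)
    (x : nonPrimitiveSelmerInfty W κ S₀ →+ AddCircle (1 : ℚ)) :
    ((isLocNil_conjNonPrimitive_sub_one W κ S₀ hγ).smulFun f x).comp
        (AddSubgroup.inclusion (selmerInfty_le_nonPrimitiveSelmerInfty W κ S₀)) =
      (W.isLocNil_conjSelmerInfty_sub_one' κ γ).smulFun f
        (x.comp (AddSubgroup.inclusion (selmerInfty_le_nonPrimitiveSelmerInfty W κ S₀))) := by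
  set h₀ := isLocNil_conjNonPrimitive_sub_one W κ S₀ hγ
  set h := W.isLocNil_conjSelmerInfty_sub_one' κ γ
  set ι := AddSubgroup.inclusion (selmerInfty_le_nonPrimitiveSelmerInfty W κ S₀) with hι
  ext s
  obtain ⟨N, hN⟩ := h.nil s
  obtain ⟨k, hk⟩ := h.torsion s
  have hN₀ : ((conjNonPrimitive W κ S₀ γ - 1) ^ N) (ι s) = 0 := by
    rw [hι, ← inclusion_conj_sub_one_pow_apply W κ γ S₀ N s, hN, map_zero]
  have hk₀ : p ^ k • ι s = 0 := by rw [← map_nsmul, hk, map_zero]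
  rw [AddMonoidHom.comp_apply, h₀.smulFun_apply f x hN₀ hk₀, h.smulFun_apply f _ hN hk,
    IwasawaDual.evalT_def, IwasawaDual.evalT_def]
  refine Finset.sum_congr rfl fun i _ ↦ ?_
  rw [AddMonoidHom.comp_apply, hι, inclusion_conj_sub_one_pow_apply W κ γ S₀ i s]

end Naturality

/-! ## §3. The restriction map `X^{Σ₀} → X`, `Λ`-linear -/

section Restrict

variable {K : Type u} [Field K] [NumberField K] {W : WeierstrassCurve K} {p : ℕ} [Fact p.Prime]
  {κ : ZpExtension K p} {γ : absoluteGaloisGroup K} {S₀ : Set (HeightOneSpectrum (𝓞 K))}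

/-- **The Pontryagin dual `X^{Σ₀} → X` of the inclusion `Sel_{p^∞}(E/K_∞) ↪ Sel^{Σ₀}_E(K_∞)_p`
exists as a `Λ`-LINEAR map** (restriction of characters, transported through the two `toDual`s):
both actions read through `toDual` are the canonical one (`SelmerDualData.toDual_smul`,
`NonPrimitiveDualData.toDual_smul`), natural along the inclusion (`smulFun_comp_inclusion`). Stated
as an existence theorem (no definition is introduced). GV Cor. (2.3): the dual of
`0 → S_A → S^{Σ₀}_A`. [cite: GreenbergVatsal2000, §2 Cor. (2.3) (arXiv:math/9906215 pp. 20–21)] -/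
theorem exists_restrictDual (hγ : κ.IsTopGenerator γ) (D : W.SelmerDualData κ γ)
    (DS : NonPrimitiveDualData W κ γ S₀) :
    ∃ r : DS.X →ₗ[IwasawaAlgebra p] D.X, ∀ x : DS.X, D.toDual (r x) =
      (DS.toDual x).comp (AddSubgroup.inclusion (selmerInfty_le_nonPrimitiveSelmerInfty W κ S₀)) := by
  have key : ∀ y, D.toDual ((AddEquiv.ofBijective D.toDual D.bijective).symm y) = y := fun y ↦
    (AddEquiv.ofBijective D.toDual D.bijective).apply_symm_apply y
  refine ⟨{ toFun := fun x ↦ (AddEquiv.ofBijective D.toDual D.bijective).symm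
              ((DS.toDual x).comp
                (AddSubgroup.inclusion (selmerInfty_le_nonPrimitiveSelmerInfty W κ S₀)))
            map_add' := fun x y ↦ by rw [← map_add, map_add, AddMonoidHom.add_comp]
            map_smul' := fun f x ↦ ?_ }, fun x ↦ key _⟩
  apply D.bijective.1
  rw [RingHom.id_apply, D.toDual_smul, key, key, NonPrimitiveDualData.toDual_smul hγ,
    smulFun_comp_inclusion W κ γ S₀ hγ]

end Restrict

/-! ## §4. No finite `Λ`-submodule in `X^{Σ₀}` from none in `X` and the divisibility of `Sel^{Σ₀}/Sel` -/

section NoFinite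

variable {K : Type u} [Field K] [NumberField K] {W : WeierstrassCurve K} {p : ℕ} [hp : Fact p.Prime]
  {κ : ZpExtension K p} {γ : absoluteGaloisGroup K} {S₀ : Set (HeightOneSpectrum (𝓞 K))}

/-- `p`-power divisibility of `Sel^{Σ₀}/Sel` from `p`-divisibility (iterate). [folklore] -/
theorem exists_pow_nsmul_sub_mem_of_divisible
    (hdiv : ∀ s ∈ nonPrimitiveSelmerInfty W κ S₀, ∃ t ∈ nonPrimitiveSelmerInfty W κ S₀,
      p • t - s ∈ W.selmerInfty κ) (a : ℕ) :
    ∀ s ∈ nonPrimitiveSelmerInfty W κ S₀, ∃ t ∈ nonPrimitiveSelmerInfty W κ S₀,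
      p ^ a • t - s ∈ W.selmerInfty κ := by
  induction a with
  | zero => exact fun s hs ↦ ⟨s, hs, by rw [pow_zero, one_nsmul, sub_self]; exact zero_mem _⟩
  | succ a ih =>
    intro s hs
    obtain ⟨t, ht, hts⟩ := ih s hs
    obtain ⟨t', ht', ht't⟩ := hdiv t ht
    refine ⟨t', ht', ?_⟩
    have e : p ^ (a + 1) • t' - s = p ^ a • (p • t' - t) + (p ^ a • t - s) := by
      rw [pow_succ, mul_nsmul', nsmul_sub]; abel
    rw [e]
    exact add_mem (AddSubgroup.nsmul_mem _ ht't _) hts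

/-- A character of the `p`-primary group `Sel^{Σ₀}_E(K_∞)_p` killed by `p^a · m` with `p ∤ m` is
killed by `p^a` (its values have `p`-power order). [folklore] -/
theorem pow_nsmul_eq_zero_of_mul_nsmul_eq_zero (χ : nonPrimitiveSelmerInfty W κ S₀ →+ AddCircle (1 : ℚ))
    {a m : ℕ} (hm : ¬ p ∣ m) (h : (p ^ a * m) • χ = 0) : p ^ a • χ = 0 := by
  ext u
  rw [AddMonoidHom.nsmul_apply, AddMonoidHom.zero_apply]
  set y : AddCircle (1 : ℚ) := p ^ a • χ u with hy
  obtain ⟨j, hj⟩ := W.exists_pow_smul_subgroupH1_ker_eq_zero κ (u : W.subgroupH1 p κ.kerSubgroup)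
  have hju : p ^ j • u = 0 := Subtype.ext (by rw [AddSubmonoidClass.coe_nsmul]; exact hj)
  have h1 : m • y = 0 := by
    have := DFunLike.congr_fun h u
    rw [AddMonoidHom.nsmul_apply, AddMonoidHom.zero_apply, mul_comm, mul_nsmul'] at this
    exact this
  have h2 : p ^ j • y = 0 := by
    rw [hy, smul_comm, ← map_nsmul, hju, map_zero, nsmul_zero]
  have hd1 : addOrderOf y ∣ m := addOrderOf_dvd_of_nsmul_eq_zero h1
  have hd2 : addOrderOf y ∣ p ^ j := addOrderOf_dvd_of_nsmul_eq_zero h2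
  have hcop : Nat.Coprime m (p ^ j) :=
    Nat.Coprime.pow_right j ((Nat.Prime.coprime_iff_not_dvd hp.out).mpr hm).symm
  exact AddMonoid.addOrderOf_eq_one_iff.mp (Nat.eq_one_of_dvd_coprimes hcop hd1 hd2)

/-- **K3: no non-zero finite `Λ`-submodule in `X^{Σ₀}`.** `K_∞/K` a `ℤ_p`-extension with
topological generator `γ`, `D` a dual datum of `Sel_{p^∞}(E/K_∞)` WITHOUT non-zero finite
`Λ`-submodules, `DS` any dual datum of `Sel^{Σ₀}_E(K_∞)_p`, and `Sel^{Σ₀}/Sel` `p`-DIVISIBLE (GV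
Cor. (2.3) `S^{Σ₀}/S ≅ ∏ 𝓗_ℓ(ℚ_∞)` with p. 17 "`𝓗_ℓ(ℚ_∞)` is a divisible group"). Then `X^{Σ₀}`
has no non-zero finite `Λ`-submodule: a finite `N ≤ X^{Σ₀}` restricts to a finite `Λ`-submodule of
`X` (along the `Λ`-linear dual of the inclusion, `exists_restrictDual`), which is `0`, so its characters kill `Sel`; they are killed by
`#N = p^a m`, hence by `p^a`; and `Sel^{Σ₀} = p^a Sel^{Σ₀} + Sel` — so they vanish. (GV's analogue of
Lemma (2.6) at the non-primitive group; the `hnf` input of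
`nonPrimitive_lambdaInvariant_eq_of_torsionIso`.) [cite: GreenbergVatsal2000, §2 Cor. (2.3), Prop. (2.5), Lemma (2.6) (arXiv:math/9906215 pp. 20–23)] -/
theorem nonPrimitive_noFiniteSubmodule_of_quotient_divisible (hγ : κ.IsTopGenerator γ)
    (D : W.SelmerDualData κ γ) (DS : NonPrimitiveDualData W κ γ S₀)
    (hdiv : ∀ s ∈ nonPrimitiveSelmerInfty W κ S₀, ∃ t ∈ nonPrimitiveSelmerInfty W κ S₀,
      p • t - s ∈ W.selmerInfty κ)
    (hnf : ∀ N : Submodule (IwasawaAlgebra p) D.X, Finite N → N = ⊥) :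
    ∀ N : Submodule (IwasawaAlgebra p) DS.X, Finite N → N = ⊥ := by
  intro N hN
  obtain ⟨r, hr⟩ := exists_restrictDual hγ D DS
  set ι := AddSubgroup.inclusion (selmerInfty_le_nonPrimitiveSelmerInfty W κ S₀) with hι
  -- the image of `N` in `X` is finite, hence `⊥`
  have hfin : ((N.map r : Submodule (IwasawaAlgebra p) D.X) : Set D.X).Finite := by
    rw [Submodule.map_coe]; exact (Set.toFinite _).image _
  have hmap : N.map r = ⊥ := hnf _ hfin.to_subtype
  -- so the characters of `N` kill `Sel`
  have hres : ∀ x ∈ N, ∀ s : W.selmerInfty κ, DS.toDual x (ι s) = 0 := by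
    intro x hx s
    have hx0 : r x = 0 := by
      rw [← Submodule.mem_bot (R := IwasawaAlgebra p), ← hmap]
      exact Submodule.mem_map_of_mem hx
    have h := hr x
    rw [hx0, map_zero] at h
    have h' := DFunLike.congr_fun h s
    rw [AddMonoidHom.zero_apply, AddMonoidHom.comp_apply] at h'
    exact h'.symm
  rw [eq_bot_iff]
  intro x hx
  rw [Submodule.mem_bot]
  -- `#N • x = 0`, `#N = p^a m`
  haveI : Finite N := hN
  have hn0 : Nat.card N ≠ 0 := Nat.card_pos.ne'
  have hnx : Nat.card N • x = 0 := by
    have := card_nsmul_eq_zero' (G := N) (x := ⟨x, hx⟩)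
    exact congrArg Subtype.val this
  obtain ⟨a, m, hm, hnam⟩ := Nat.exists_eq_pow_mul_and_not_dvd hn0 p hp.out.ne_one
  -- `χ = toDual x` is killed by `p^a` and kills `Sel`; divisibility finishes
  have hχa : p ^ a • DS.toDual x = 0 :=
    pow_nsmul_eq_zero_of_mul_nsmul_eq_zero (DS.toDual x) hm (by rw [← hnam, ← map_nsmul, hnx, map_zero])
  suffices hχ : DS.toDual x = 0 from DS.bijective.1 (by rw [hχ, map_zero])
  ext s
  obtain ⟨t, ht, hts⟩ := exists_pow_nsmul_sub_mem_of_divisible hdiv a s s.2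
  set d : nonPrimitiveSelmerInfty W κ S₀ := p ^ a • ⟨t, ht⟩ - s with hd
  have hdSel : (d : W.subgroupH1 p κ.kerSubgroup) ∈ W.selmerInfty κ := by
    rw [hd, AddSubgroupClass.coe_sub, AddSubmonoidClass.coe_nsmul]; exact hts
  have hd0 : DS.toDual x d = 0 := by
    have := hres x hx ⟨d, hdSel⟩
    rwa [hι] at this
  have hs : s = p ^ a • ⟨t, ht⟩ - d := by rw [hd, sub_sub_cancel]
  rw [AddMonoidHom.zero_apply, hs, map_sub, hd0, sub_zero, map_nsmul, ← AddMonoidHom.nsmul_apply,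
    hχa, AddMonoidHom.zero_apply]

end NoFinite

/-! ## §5. Over `ℚ`: from Greenberg's Prop. 4.14 on the primitive dual -/

section Rat

variable {W : WeierstrassCurve ℚ} [W.IsElliptic] [W.IsGloballyMinimal] {p : ℕ} [hp : Fact p.Prime]
  {κ : ZpExtension ℚ p} {γ : absoluteGaloisGroup ℚ} {S₀ : Set (HeightOneSpectrum (𝓞 ℚ))}

/-- **`X^{Σ₀} = Sel^{Σ₀}_E(ℚ_∞)_p^` has no non-zero finite `Λ`-submodule**, for EVERY dual datum `DS`,
modulo Greenberg 1999 Prop. 4.14 (tree record A234 `prop414_noFiniteSubmodule_of_not_dvd_torsionOrder`,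
binder `h414`): `E/ℚ` globally minimal, `p ∤ #E(ℚ)_tors`, `κ` cyclotomic with topological generator
`γ`, `Sel_{p^∞}(E/ℚ_∞)` `Λ`-cotorsion (some f.g. torsion dual datum `D`), and `Sel^{Σ₀}/Sel`
`p`-divisible (GV Cor. (2.3) + p. 17; binder `hdiv`, the classical-currency form of T-GV23L's
conclusion 5). This is the `hnf` input of gen-5 FILE 5 `…nonPrimitive_lambdaInvariant_eq_of_torsionIso`
on either side of a link. [cite: GreenbergLNM1716, Prop. 4.14]
[cite: GreenbergVatsal2000, §2 Cor. (2.3) (arXiv:math/9906215 pp. 20–21)] -/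
theorem nonPrimitive_noFiniteSubmodule_of_prop414
    (h414 : Greenberg1999.prop414_noFiniteSubmodule_of_not_dvd_torsionOrder)
    (htors : ¬ p ∣ W.torsionOrder) (hκ : κ.IsCyclotomic) (hγ : κ.IsTopGenerator γ)
    (D : W.SelmerDualData κ γ) [Module.Finite (IwasawaAlgebra p) D.X] (hD : D.IsTorsion)
    (DS : NonPrimitiveDualData W κ γ S₀)
    (hdiv : ∀ s ∈ nonPrimitiveSelmerInfty W κ S₀, ∃ t ∈ nonPrimitiveSelmerInfty W κ S₀,
      p • t - s ∈ W.selmerInfty κ) :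
    ∀ N : Submodule (IwasawaAlgebra p) DS.X, Finite N → N = ⊥ :=
  nonPrimitive_noFiniteSubmodule_of_quotient_divisible hγ D DS hdiv (h414 W p htors κ γ hκ hγ D hD)

end Rat

end Summit.BirchSwinnertonDyer.Rank1Residual.Additive

end
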